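import Summits.Ventures.LatticeQCDFlow.Scaling.SimulatedTemperingModeTorpid

/-!
HONEST FRAMING: exact (Metropolis-corrected) sampling algorithms for lattice gauge theory; figures
of merit are autocorrelation/cost numbers at stated couplings and volumes; no continuum-physics
claim.

# LevelSchemeSectorCeiling — NO LEVEL-PROPOSAL SCHEME BEATS TUNNELLING IN SIMULATED TEMPERING EITHER: FOR
# `P = t·Q + (1−t)·W` ON `Fin (K+1) × S` WITH `Q` ANY `π`-REVERSIBLE LEVEL MOVE THAT KEEPS THE CONFIGURATION'S SECTOR
# (ladder or long-range proposals, learned maps between couplings that respect sectors),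
# `Gap(P) ≤ (1−t)(K+1)·Σ_k Q_k(A,Aᶜ)/(m_A((K+1) − m_A))`; ONE TUNNELLING LEVEL: `Gap(P) ≤ (1−t)Q_0(A,Aᶜ)/((K+1)a(1−a))`
# (lean-2 GEN-19, ours)

Venture-side (OURS).  Cell `lqcd-flow` (pub-lqcd), unit `pub-lqcd-lean-2-g19`, 2026-08-25.  The simulated-tempering
companion of `Scaling/ExchangeSchemeSectorCeiling`, in the setting of `Scaling/SimulatedTemperingFiniteSampler`:
target `π(k,x) = μ_k(x)/(K+1)` (`stFinLaw`), within-level update `W = stFinWithin M`, and a LEVEL MOVE `Q`: any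
row-stochastic `π`-reversible kernel with `Q(p,q) > 0 ⇒ (q.2 ∈ A ↔ p.2 ∈ A)` (the Metropolis ladder move
`stFinLevel` keeps the configuration; the map-assisted level moves of `SimulatedTemperingFlowSampler` keep the sector
when the maps do).  `m_A = Σ_k μ_k(A)`.

## What is proved

* §1 `levelScheme_edgeMeasure_product` — `Q_P(T,Tᶜ) = ((1−t)/(K+1))·Σ_k Q_k(A,Aᶜ)` for `T = univ ×ˢ A`;
  (`stFinWithin_edgeMeasure_product` — the `t = 0` reading of `stFin_edgeMeasure_product`).
* §2 **`levelScheme_spectralGap_le_sector`** — the ceiling of the title (`0 ≤ t ≤ 1`, `0 < m_A < K+1`);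
  **`levelScheme_spectralGap_le_hot`** — sector-frozen cold levels (`Q_k(A,Aᶜ) = 0`, `k ≥ 1`) and
  `a ≤ μ_k(A) ≤ 1 − a` at every level (`0 < a`): `Gap(P) ≤ (1−t)·Q_0(A,Aᶜ)/((K+1)·a(1−a))` — order `K⁻¹` (one walker,
  `K+1` levels), against replica exchange's `K⁻²` (`ExchangeSchemeSectorCeiling`: `K+1` walkers, one tunnelling).

Reading (no numerics implied): learned level proposals and coupling-to-coupling maps change the acceptance of level
moves, never the rate at which the single walker's configuration changes sector; that rate is set by the within-level
updates alone.  NOT CLAIMED: level moves that themselves cross sectors; anything measured.  Literature grade (cell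
rule): KNOWN MECHANISM (bottleneck test functions), NEW TYPING (universal over level moves); nothing cited as a fact;
no new bib keys.
-/

noncomputable section

open Finset Function
open Literature.Probability.MarkovChains

namespace Summit.Ventures.LatticeQCDFlow.Scaling

variable {S : Type*} [Fintype S] [DecidableEq S] {K : ℕ} {μ : Fin (K + 1) → S → ℝ}
  {M : Fin (K + 1) → Matrix S S ℝ} {t : ℝ}

/-! ## §1 The exit flow from `T = univ ×ˢ A` -/

/-- **The within-level update's exit flow from `T`:** `Q_W(T,Tᶜ) = (1/(K+1))·Σ_k Q_k(A,Aᶜ)`. [ours] -/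
theorem stFinWithin_edgeMeasure_product (A : Finset S) :
    edgeMeasure (stFinLaw μ) (stFinWithin M) ((univ : Finset (Fin (K + 1))) ×ˢ A)
        (((univ : Finset (Fin (K + 1))) ×ˢ A)ᶜ)
      = 1 / (K + 1) * ∑ k, edgeMeasure (μ k) (M k) A Aᶜ := by
  have h := stFin_edgeMeasure_product (μ := μ) (M := M) (t := 0) A
  have e : edgeMeasure (stFinLaw μ) (stFinSampler 0 μ M) ((univ : Finset (Fin (K + 1))) ×ˢ A)
        (((univ : Finset (Fin (K + 1))) ×ˢ A)ᶜ)
      = edgeMeasure (stFinLaw μ) (stFinWithin M) ((univ : Finset (Fin (K + 1))) ×ˢ A)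
        (((univ : Finset (Fin (K + 1))) ×ˢ A)ᶜ) := by
    unfold edgeMeasure
    refine sum_congr rfl fun p _ => sum_congr rfl fun q _ => ?_
    rw [stFinSampler_apply]; ring
  rw [← e, h]; ring

/-- **A sector-keeping level move never leaves `T`; the sampler's exit flow is the update's:**
`Q_P(T,Tᶜ) = ((1−t)/(K+1))·Σ_k Q_k(A,Aᶜ)`. [ours] -/
theorem levelScheme_edgeMeasure_product {Q : Matrix (Fin (K + 1) × S) (Fin (K + 1) × S) ℝ} {A : Finset S}
    (hQA : ∀ p q, Q p q ≠ 0 → (q.2 ∈ A ↔ p.2 ∈ A)) (t : ℝ) :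
    edgeMeasure (stFinLaw μ) (fun p q => t * Q p q + (1 - t) * stFinWithin M p q)
        ((univ : Finset (Fin (K + 1))) ×ˢ A) (((univ : Finset (Fin (K + 1))) ×ˢ A)ᶜ)
      = (1 - t) / (K + 1) * ∑ k, edgeMeasure (μ k) (M k) A Aᶜ := by
  have hW : ∑ p ∈ (univ : Finset (Fin (K + 1))) ×ˢ A, ∑ q ∈ ((univ : Finset (Fin (K + 1))) ×ˢ A)ᶜ,
      stFinLaw μ p * stFinWithin M p q = 1 / (K + 1) * ∑ k, edgeMeasure (μ k) (M k) A Aᶜ :=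
    stFinWithin_edgeMeasure_product (μ := μ) (M := M) A
  unfold edgeMeasure
  have hzero : ∀ p ∈ (univ : Finset (Fin (K + 1))) ×ˢ A, ∀ q ∈ ((univ : Finset (Fin (K + 1))) ×ˢ A)ᶜ,
      Q p q = 0 := by
    intro p hp q hq
    by_contra h
    rw [Finset.mem_compl, Finset.mem_product] at hq
    rw [Finset.mem_product] at hp
    exact hq ⟨mem_univ _, (hQA p q h).mpr hp.2⟩
  calc ∑ p ∈ (univ : Finset (Fin (K + 1))) ×ˢ A, ∑ q ∈ ((univ : Finset (Fin (K + 1))) ×ˢ A)ᶜ,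
        stFinLaw μ p * (t * Q p q + (1 - t) * stFinWithin M p q)
      = (1 - t) * ∑ p ∈ (univ : Finset (Fin (K + 1))) ×ˢ A, ∑ q ∈ ((univ : Finset (Fin (K + 1))) ×ˢ A)ᶜ,
          stFinLaw μ p * stFinWithin M p q := by
        rw [Finset.mul_sum]
        refine sum_congr rfl fun p hp => ?_
        rw [Finset.mul_sum]
        refine sum_congr rfl fun q hq => ?_
        rw [hzero p hp q hq]; ring
    _ = (1 - t) / (K + 1) * ∑ k, edgeMeasure (μ k) (M k) A Aᶜ := by rw [hW]; ring

/-! ## §2 The universal ceiling for level schemes -/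

/-- **NO LEVEL-PROPOSAL SCHEME BEATS TUNNELLING:** for any row-stochastic `π`-reversible sector-keeping level move `Q`,
`0 ≤ t ≤ 1`, `0 < m_A < K+1`: `Gap(tQ + (1−t)W) ≤ (1−t)(K+1)·Σ_k Q_k(A,Aᶜ)/(m_A((K+1) − m_A))`. [ours] -/
theorem levelScheme_spectralGap_le_sector (hμ : ∀ k x, 0 < μ k x) (hμ1 : ∀ k, ∑ x, μ k x = 1)
    (hM : ∀ k, IsRowStochastic (M k)) (hMrev : ∀ k, DetailedBalance (μ k) (M k)) (ht0 : 0 ≤ t) (ht1 : t ≤ 1)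
    {Q : Matrix (Fin (K + 1) × S) (Fin (K + 1) × S) ℝ} (hQ : IsRowStochastic Q)
    (hQrev : DetailedBalance (stFinLaw μ) Q) (A : Finset S) (hQA : ∀ p q, Q p q ≠ 0 → (q.2 ∈ A ↔ p.2 ∈ A))
    (hA0 : 0 < ∑ k, ∑ x ∈ A, μ k x) (hA1 : ∑ k, ∑ x ∈ A, μ k x < K + 1) :
    spectralGap (stFinLaw μ) (fun p q => t * Q p q + (1 - t) * stFinWithin M p q)
      ≤ (1 - t) * (K + 1) * (∑ k, edgeMeasure (μ k) (M k) A Aᶜ)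
          / ((∑ k, ∑ x ∈ A, μ k x) * ((K + 1) - ∑ k, ∑ x ∈ A, μ k x)) := by
  haveI := stFin_nontrivial_of_mass (μ := μ) hμ1 hA0 hA1
  set T := (univ : Finset (Fin (K + 1))) ×ˢ A with hT
  have hWst := stFinWithin_isRowStochastic (K := K) hM
  have hWrev := stFinWithin_detailedBalance (μ := μ) hMrev
  have hP : IsRowStochastic (fun p q : Fin (K + 1) × S => t * Q p q + (1 - t) * stFinWithin M p q) := by
    refine ⟨fun p q => add_nonneg (mul_nonneg ht0 (hQ.1 p q)) (mul_nonneg (by linarith) (hWst.1 p q)),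
      fun p => ?_⟩
    simp only
    rw [Finset.sum_add_distrib, ← Finset.mul_sum, ← Finset.mul_sum, hQ.2 p, hWst.2 p]; ring
  have hDB : DetailedBalance (stFinLaw μ) (fun p q : Fin (K + 1) × S => t * Q p q + (1 - t) * stFinWithin M p q) := by
    intro p q
    have h1 := hQrev p q
    have h2 := hWrev p q
    simp only
    calc stFinLaw μ p * (t * Q p q + (1 - t) * stFinWithin M p q)
        = t * (stFinLaw μ p * Q p q) + (1 - t) * (stFinLaw μ p * stFinWithin M p q) := by ring
      _ = t * (stFinLaw μ q * Q q p) + (1 - t) * (stFinLaw μ q * stFinWithin M q p) := by rw [h1, h2]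
      _ = _ := by ring
  have hst : IsStationary (stFinLaw μ) (fun p q => t * Q p q + (1 - t) * stFinWithin M p q) := hDB.isStationary hP.2
  have hπ1 := sum_stFinLaw (K := K) hμ1
  have hK : (0 : ℝ) < K + 1 := by positivity
  have hmT : ∑ p ∈ T, stFinLaw μ p = (∑ k, ∑ x ∈ A, μ k x) / (K + 1) := stFin_mass_product A
  have hmTc : ∑ p ∈ Tᶜ, stFinLaw μ p = ((K + 1) - ∑ k, ∑ x ∈ A, μ k x) / (K + 1) := by
    have h := sum_add_sum_compl T (stFinLaw μ)
    rw [hπ1, hmT] at h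
    field_simp at h
    rw [eq_div_iff hK.ne']
    linarith
  have hVar : lawVariance (stFinLaw μ) (bottleneckTestFun (stFinLaw μ) T)
      = (∑ k, ∑ x ∈ A, μ k x) / (K + 1) * (((K + 1) - ∑ k, ∑ x ∈ A, μ k x) / (K + 1)) := by
    rw [lawVariance_bottleneckTestFun hπ1, hmT, hmTc]
  have hVpos : 0 < lawVariance (stFinLaw μ) (bottleneckTestFun (stFinLaw μ) T) := by
    rw [hVar]; exact mul_pos (div_pos hA0 hK) (div_pos (by linarith) hK)
  have hE : dirichletForm (stFinLaw μ) (fun p q => t * Q p q + (1 - t) * stFinWithin M p q)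
      (bottleneckTestFun (stFinLaw μ) T) = (1 - t) / (K + 1) * ∑ k, edgeMeasure (μ k) (M k) A Aᶜ := by
    rw [dirichletForm_bottleneckTestFun hP hst hπ1, hT, levelScheme_edgeMeasure_product hQA]
  rw [LevinPeres2017_lemma_13_7 (stFinLaw_pos hμ) hπ1 hP hDB]
  refine (spectralGapR_le_dirichletForm_div_lawVariance (fun p => (stFinLaw_pos hμ p).le) hπ1 hP.1 hVpos).trans
    (le_of_eq ?_)
  rw [hE, hVar]
  field_simp

/-- **ONE TUNNELLING LEVEL CAPS EVERY LEVEL SCHEME AT ORDER `K`:** cold levels sector-frozen (`Q_k(A,Aᶜ) = 0`,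
`k ≥ 1`), `a ≤ μ_k(A) ≤ 1 − a` at every level (`0 < a`), any sector-keeping level move:
`Gap(tQ + (1−t)W) ≤ (1−t)·Q_0(A,Aᶜ)/((K+1)·a·(1−a))`. [ours] -/
theorem levelScheme_spectralGap_le_hot (hμ : ∀ k x, 0 < μ k x) (hμ1 : ∀ k, ∑ x, μ k x = 1)
    (hM : ∀ k, IsRowStochastic (M k)) (hMrev : ∀ k, DetailedBalance (μ k) (M k)) (ht0 : 0 ≤ t) (ht1 : t ≤ 1)
    {Q : Matrix (Fin (K + 1) × S) (Fin (K + 1) × S) ℝ} (hQ : IsRowStochastic Q)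
    (hQrev : DetailedBalance (stFinLaw μ) Q) {A : Finset S} (hQA : ∀ p q, Q p q ≠ 0 → (q.2 ∈ A ↔ p.2 ∈ A))
    {a : ℝ} (ha : 0 < a) (haA : ∀ k, a ≤ ∑ x ∈ A, μ k x) (haAc : ∀ k, ∑ x ∈ A, μ k x ≤ 1 - a)
    (hfrozen : ∀ k : Fin (K + 1), k ≠ 0 → edgeMeasure (μ k) (M k) A Aᶜ = 0) :
    spectralGap (stFinLaw μ) (fun p q => t * Q p q + (1 - t) * stFinWithin M p q)
      ≤ (1 - t) * edgeMeasure (μ 0) (M 0) A Aᶜ / ((K + 1) * (a * (1 - a))) := by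
  have hK : (0 : ℝ) < K + 1 := by positivity
  -- `(K+1)a ≤ m_A ≤ (K+1)(1−a)`
  have hmlo : (K + 1) * a ≤ ∑ k, ∑ x ∈ A, μ k x :=
    calc ((K : ℝ) + 1) * a = ∑ _k : Fin (K + 1), a := by
          rw [Finset.sum_const, Finset.card_univ, Fintype.card_fin, nsmul_eq_mul]; push_cast; ring
      _ ≤ _ := sum_le_sum fun k _ => haA k
  have hmhi : ∑ k, ∑ x ∈ A, μ k x ≤ (K + 1) * (1 - a) :=
    calc ∑ k, ∑ x ∈ A, μ k x ≤ ∑ _k : Fin (K + 1), (1 - a) := sum_le_sum fun k _ => haAc k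
      _ = ((K : ℝ) + 1) * (1 - a) := by
          rw [Finset.sum_const, Finset.card_univ, Fintype.card_fin, nsmul_eq_mul]; push_cast; ring
  have ha1 : a ≤ 1 - a := (haA 0).trans (haAc 0)
  have hA0 : 0 < ∑ k, ∑ x ∈ A, μ k x := lt_of_lt_of_le (by positivity) hmlo
  have hA1 : ∑ k, ∑ x ∈ A, μ k x < K + 1 := lt_of_le_of_lt hmhi (by nlinarith)
  have h := levelScheme_spectralGap_le_sector (t := t) (M := M) hμ hμ1 hM hMrev ht0 ht1 hQ hQrev A hQA hA0 hA1
  have hQsum : ∑ k : Fin (K + 1), edgeMeasure (μ k) (M k) A Aᶜ = edgeMeasure (μ 0) (M 0) A Aᶜ := by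
    rw [Finset.sum_eq_single (0 : Fin (K + 1)) (fun k _ hk => hfrozen k hk) (fun h => absurd (mem_univ _) h)]
  rw [hQsum] at h
  have hE0 : 0 ≤ edgeMeasure (μ 0) (M 0) A Aᶜ := by
    unfold edgeMeasure
    exact sum_nonneg fun x _ => sum_nonneg fun y _ => mul_nonneg (hμ 0 x).le ((hM 0).1 x y)
  have hnum : 0 ≤ (1 - t) * (K + 1) * edgeMeasure (μ 0) (M 0) A Aᶜ := mul_nonneg (mul_nonneg (by linarith) hK.le) hE0
  -- the product `m_A((K+1) − m_A) ≥ (K+1)²·a(1−a)` (concavity: minimum at the ends of the interval)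
  set m := ∑ k, ∑ x ∈ A, μ k x with hm
  have hprod : (K + 1) ^ 2 * (a * (1 - a)) ≤ m * ((K + 1) - m) := by
    nlinarith [hmlo, hmhi, mul_nonneg (sub_nonneg.mpr hmlo) (sub_nonneg.mpr hmhi)]
  have hden : 0 < (K + 1) ^ 2 * (a * (1 - a)) := by
    have : 0 < 1 - a := by linarith
    positivity
  calc spectralGap (stFinLaw μ) (fun p q => t * Q p q + (1 - t) * stFinWithin M p q)
      ≤ (1 - t) * (K + 1) * edgeMeasure (μ 0) (M 0) A Aᶜ / (m * ((K + 1) - m)) := h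
    _ ≤ (1 - t) * (K + 1) * edgeMeasure (μ 0) (M 0) A Aᶜ / ((K + 1) ^ 2 * (a * (1 - a))) :=
        div_le_div_of_nonneg_left hnum hden hprod
    _ = (1 - t) * edgeMeasure (μ 0) (M 0) A Aᶜ / ((K + 1) * (a * (1 - a))) := by
        field_simp

end Summit.Ventures.LatticeQCDFlow.Scaling

end
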